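import Summits.QuantumFields.YangMills.Theorems.BalabanUVNodesN15KingModelHeatKernelSymbolDerivatives
import HarnessLib

/-!
# BalabanUVNodes ∕ N15 — THE KING-MODEL RUNG (PART ∇-a): HALF-POWER GAUSSIAN LOCALISATIONS OF THE FIRST THREE DERIVATIVES OF THE HEAT SYMBOL —
# `|∂_θ e^{−σ(1−cos θ)}| ≤ √σ·e^{−(σ∕4)(1−cos θ)}`, `|∂_θ²…| ≤ 2σ·e^{−(σ∕4)(1−cos θ)}`, `|∂_θ³…| ≤ (1+5σ)√σ·e^{−(σ∕4)(1−cos θ)}`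
# (the analytic input of PART ∇: the η-uniform inverse-CUBE law for the lattice GRADIENT of King's `A = 0` covariance in four dimensions)
# (Track A, DAG node N15 = NE2; FAN-OUT v1.1 §N15 s3 «KING-MODEL RUNG … + what the curved case adds»; count-neutral)

HONEST FRAMING.  Count-neutral (cell `pub-ymgap`, seat `pub-ymgap-dag-n15-e` g57; `--supports stmt-QuantumFields-27247 --as helper` = K3ᴬ, KEY MAP v3).  Elementary one-variable
calculus about the symbol `heat σ θ = e^{−σ(1−cos θ)}` (the tree's `SRWGreen.heat`) and PART Ϣ-a's closed forms `kingHeatD1 … kingHeatD3` of its first three `θ`-derivatives; no lattice,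
no torus, no field theory in this file.  WHY IT IS HERE: PART Ϣ proved `c·|G(x,y)| ≤ C₀∕(1+‖x−y‖²_∞) + 8c∕(m²K₀⁴)` for King's covariance `G = (c(−Δ)+m²)⁻¹` on the four-torus by
subordination and FOUR summations by parts on the cycle heat kernel `Q_s(n) = K⁻¹Σ_k heat(2s)(θ_k)ψ(kn)`; the fourth differences were bounded through `sup|∂⁴heat| ≤ (7σ+21σ²)e^{−(σ∕2)(1−cos)}`
(PART Ϣ-a), i.e. `O(σ²)` times a Gaussian window.  PART ∇ bounds the lattice GRADIENT `G(x+e_ν,y) − G(x,y)`, whose one-dimensional factor is the DIFFERENCED cycle kernel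
`∇Q_s(n) = K⁻¹Σ_k heat(2s)(θ_k)·(ψ(k)−1)·ψ(kn)`; Boole's Leibniz rule for `Δ⁴(heat·(ψ−1))` (PART ∇-c) produces the products `Δ^j heat · Δ^{4−j}(ψ−1)`, `j = 0…4`, and the gain of
ONE HALF-POWER of `σ = 2s` — which is what turns the inverse square into the inverse cube after the time integral — must be harvested from EACH of them: for `j = 4` from the extra factor
`|ψ(k+4)−1| ≤ 2π(|v(k)|+4)∕K` against the second quarter of the Gaussian, and for `j = 1, 2, 3` from the bounds of THIS file, in which every `sin θ` carried by `∂^jheat` is cashed as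
`|sin θ|·e^{−(3σ∕4)(1−cos θ)} ≤ 1∕√(2σ)` (`sin² ≤ 2(1−cos)`, `xe^{−x} ≤ e⁻¹`): `∂heat = O(√σ)`, `∂²heat = O(σ)`, `∂³heat = O(σ^{3∕2})`, each against the LAST quarter `e^{−(σ∕4)(1−cos θ)}` of the
Gaussian (PART ∇-c sums that quarter over the windows with PART Ϣ-c's window bound at half time).
CONTENTS.  §1 the splitting `heat = e^{−(3σ∕4)Y}·e^{−(σ∕4)Y}` (`Y = 1−cos θ`), `heat ≤ e^{−(σ∕4)Y}`, `e^{−(σ∕2)Y} = (e^{−(σ∕4)Y})²`, and the two scalar suprema ★ `sin_sq_mul_exp_le`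
(`sin²θ·e^{−2bY} ≤ 3∕(8b)`) and `mul_one_sub_cos_mul_exp_le` (`bY·e^{−bY} ≤ 3∕8`); §2 the three squared keys `(σ|sin|e^{−(3σ∕4)Y})² ≤ σ`, `σ²sin²e^{−(3σ∕4)Y} ≤ σ`,
`(σ³|sin|³e^{−(3σ∕4)Y})² ≤ 4σ³`; §3 ★★ **`abs_kingHeatD1_le`** (`|∂heat| ≤ √σ·e^{−(σ∕4)Y}`), ★★ **`abs_kingHeatD2_le`** (`|∂²heat| ≤ 2σ·e^{−(σ∕4)Y}`), ★★ **`abs_kingHeatD3_le`**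
(`|∂³heat| ≤ (1+5σ)√σ·e^{−(σ∕4)Y}`), ★ `abs_kingHeatD4_le_quarter_sq` (PART Ϣ-a's bound respelled `(7σ+21σ²)·(e^{−(σ∕4)Y})²`), and the chain form ★ `abs_kingHeatChain_le_quarter` (`j ≤ 3`).
PRIOR TREE ART (by name, not restated): PART Ϣ-a (`kingHeatD1…D4`, `kingHeatChain`, `abs_kingHeatD4_le`, `sin_sq_le_two_mul_one_sub_cos`, `heat_le_exp_half`); `SRWGreen.heat` ∕ `heat_pos` ∕
`heat_le_one`; Mathlib `Real.mul_exp_neg_le_exp_neg_one`, `Real.exp_neg_one_lt_d9`, `Real.abs_le_sqrt`.  The one-liner `x·e^{−bx} ≤ e⁻¹∕b` is the tree's `T4JointInsertionProfile.mul_exp_neg_mul_le`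
(not imported into PART Ϣ∕∇; used inline from Mathlib).
Dedup (rg at filing): basename 0 files; needles `abs_kingHeatD1_le|abs_kingHeatD2_le|abs_kingHeatD3_le|sin_sq_mul_exp_le|heat_eq_threeQuarter_mul_quarter|abs_kingHeatChain_le_quarter` 0 tree files.
Locators: [King1986] (2.13) p.653, (4.4) p.670 (the symbol `2−2cos` of `−Δ`), (3.63) p.663 (the gradient entries these bounds serve); [LawlerLimic2010] §2.3 for the method; the
inequalities themselves are [folklore].  0 `sorry`; 0 `def`.
-/

noncomputable section

open Real Set

namespace Summit.QuantumFields.YangMills.BalabanUVNodes.N15KingModelRung.HeatKernel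

open Literature.Barriers.CriticalPhenomena.SRWGreen (heat heat_le_one heat_pos)

/-! ## §1 Splitting the Gaussian into three quarters and one quarter; two scalar suprema -/

/-- `heat σ θ = e^{−(3σ∕4)(1−cos θ)}·e^{−(σ∕4)(1−cos θ)}`. [folklore] -/
theorem heat_eq_threeQuarter_mul_quarter (σ θ : ℝ) :
    heat σ θ = Real.exp (-(3 * σ / 4 * (1 - Real.cos θ))) * Real.exp (-(σ / 4 * (1 - Real.cos θ))) := by
  unfold heat; rw [← Real.exp_add]; ring_nf

/-- `e^{−(σ∕2)(1−cos θ)} = (e^{−(σ∕4)(1−cos θ)})²`. [folklore] -/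
theorem exp_half_eq_quarter_sq (σ θ : ℝ) :
    Real.exp (-(σ / 2 * (1 - Real.cos θ))) = Real.exp (-(σ / 4 * (1 - Real.cos θ))) ^ 2 := by
  rw [sq, ← Real.exp_add]; ring_nf

/-- `e^{−b(1−cos θ)} ≤ 1` for `b ≥ 0`. [folklore] -/
theorem exp_neg_mul_one_sub_cos_le_one {b : ℝ} (hb : 0 ≤ b) (θ : ℝ) : Real.exp (-(b * (1 - Real.cos θ))) ≤ 1 := by
  rw [Real.exp_le_one_iff, neg_nonpos]
  exact mul_nonneg hb (by linarith [Real.cos_le_one θ])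

/-- `heat σ θ ≤ e^{−(σ∕4)(1−cos θ)}` for `σ ≥ 0`. [folklore] -/
theorem heat_le_exp_quarter {σ : ℝ} (hσ : 0 ≤ σ) (θ : ℝ) : heat σ θ ≤ Real.exp (-(σ / 4 * (1 - Real.cos θ))) := by
  rw [heat_eq_threeQuarter_mul_quarter]
  have h1 := exp_neg_mul_one_sub_cos_le_one (b := 3 * σ / 4) (by positivity) θ
  have h0 : 0 ≤ Real.exp (-(σ / 4 * (1 - Real.cos θ))) := (Real.exp_pos _).le
  calc _ ≤ 1 * Real.exp (-(σ / 4 * (1 - Real.cos θ))) := mul_le_mul_of_nonneg_right h1 h0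
    _ = _ := one_mul _

/-- ★ `b(1−cos θ)·e^{−b(1−cos θ)} ≤ 3∕8` (`xe^{−x} ≤ e⁻¹ < 3∕8`, Mathlib `Real.mul_exp_neg_le_exp_neg_one`, `Real.exp_neg_one_lt_d9`; the one-liner `e⁻¹ < 3∕8` is a BalabanUV∕Beta lemma —
cited, not imported, used inline). [folklore] -/
theorem mul_one_sub_cos_mul_exp_le (b θ : ℝ) : b * (1 - Real.cos θ) * Real.exp (-(b * (1 - Real.cos θ))) ≤ 3 / 8 :=
  have he : Real.exp (-1) < 3 / 8 := lt_trans Real.exp_neg_one_lt_d9 (by norm_num)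
  (Real.mul_exp_neg_le_exp_neg_one _).trans he.le

/-- ★ **THE HALF-POWER SUPREMUM**: `sin²θ·e^{−2b(1−cos θ)} ≤ 3∕(8b)` for `b > 0` (`sin² = (1−cos)(1+cos) ≤ 2(1−cos)` and `2bY·e^{−2bY} ≤ e⁻¹`) — squared form of
`|sin θ|·e^{−b(1−cos θ)} ≤ √(3∕(8b))`: one `sin` is worth `b^{−1∕2}` against the Gaussian. [folklore] -/
theorem sin_sq_mul_exp_le {b : ℝ} (hb : 0 < b) (θ : ℝ) : Real.sin θ ^ 2 * Real.exp (-(2 * b * (1 - Real.cos θ))) ≤ 3 / (8 * b) := by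
  have hY0 : 0 ≤ 1 - Real.cos θ := by linarith [Real.cos_le_one θ]
  have hs := sin_sq_le_two_mul_one_sub_cos θ
  have h1 := mul_one_sub_cos_mul_exp_le (2 * b) θ
  have he0 : 0 ≤ Real.exp (-(2 * b * (1 - Real.cos θ))) := (Real.exp_pos _).le
  rw [le_div_iff₀ (by positivity)]
  calc Real.sin θ ^ 2 * Real.exp (-(2 * b * (1 - Real.cos θ))) * (8 * b)
      ≤ 2 * (1 - Real.cos θ) * Real.exp (-(2 * b * (1 - Real.cos θ))) * (8 * b) := by gcongr
    _ = 8 * (2 * b * (1 - Real.cos θ) * Real.exp (-(2 * b * (1 - Real.cos θ)))) := by ring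
    _ ≤ 8 * (3 / 8) := by linarith
    _ = 3 := by norm_num

/-! ## §2 The three squared keys -/

/-- KEY 1: `(σ·|sin θ|·e^{−(3σ∕4)(1−cos θ)})² ≤ σ` (`σ ≥ 0`): one `sin` against three quarters of the Gaussian. [folklore] -/
theorem key_D1_sq_le {σ : ℝ} (hσ : 0 ≤ σ) (θ : ℝ) : (σ * |Real.sin θ| * Real.exp (-(3 * σ / 4 * (1 - Real.cos θ)))) ^ 2 ≤ σ := by
  rcases hσ.eq_or_lt with h0 | hpos
  · subst h0; simp
  have h := sin_sq_mul_exp_le (b := 3 * σ / 4) (by positivity) θ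
  have e : (σ * |Real.sin θ| * Real.exp (-(3 * σ / 4 * (1 - Real.cos θ)))) ^ 2
      = σ ^ 2 * (Real.sin θ ^ 2 * Real.exp (-(2 * (3 * σ / 4) * (1 - Real.cos θ)))) := by
    rw [mul_pow, mul_pow, sq_abs, show Real.exp (-(3 * σ / 4 * (1 - Real.cos θ))) ^ 2 = Real.exp (-(2 * (3 * σ / 4) * (1 - Real.cos θ))) by
      rw [sq, ← Real.exp_add]; ring_nf]
    ring
  rw [e]
  have e2 : 3 / (8 * (3 * σ / 4)) = 1 / (2 * σ) := by field_simp; ring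
  rw [e2] at h
  calc σ ^ 2 * (Real.sin θ ^ 2 * Real.exp (-(2 * (3 * σ / 4) * (1 - Real.cos θ)))) ≤ σ ^ 2 * (1 / (2 * σ)) := mul_le_mul_of_nonneg_left h (by positivity)
    _ = σ / 2 := by field_simp
    _ ≤ σ := by linarith

/-- KEY 1, extracted: `σ·|sin θ|·e^{−(3σ∕4)(1−cos θ)} ≤ √σ`. [folklore] -/
theorem key_D1_le_sqrt {σ : ℝ} (hσ : 0 ≤ σ) (θ : ℝ) : σ * |Real.sin θ| * Real.exp (-(3 * σ / 4 * (1 - Real.cos θ))) ≤ Real.sqrt σ := by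
  have h := Real.abs_le_sqrt (key_D1_sq_le hσ θ)
  rwa [abs_of_nonneg (by positivity)] at h

/-- KEY 2: `σ²·sin²θ·e^{−(3σ∕4)(1−cos θ)} ≤ σ` (`σ ≥ 0`): `sin² ≤ 2Y` and `(3σ∕4)Y·e^{−(3σ∕4)Y} ≤ 3∕8`, so the left side is `≤ (8σ∕3)(3∕8)`. [folklore] -/
theorem key_D2_le {σ : ℝ} (hσ : 0 ≤ σ) (θ : ℝ) : σ ^ 2 * Real.sin θ ^ 2 * Real.exp (-(3 * σ / 4 * (1 - Real.cos θ))) ≤ σ := by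
  have hY0 : 0 ≤ 1 - Real.cos θ := by linarith [Real.cos_le_one θ]
  have hs := sin_sq_le_two_mul_one_sub_cos θ
  have h1 := mul_one_sub_cos_mul_exp_le (3 * σ / 4) θ
  have he0 : 0 ≤ Real.exp (-(3 * σ / 4 * (1 - Real.cos θ))) := (Real.exp_pos _).le
  calc σ ^ 2 * Real.sin θ ^ 2 * Real.exp (-(3 * σ / 4 * (1 - Real.cos θ)))
      ≤ σ ^ 2 * (2 * (1 - Real.cos θ)) * Real.exp (-(3 * σ / 4 * (1 - Real.cos θ))) := by gcongr
    _ = 8 * σ / 3 * (3 * σ / 4 * (1 - Real.cos θ) * Real.exp (-(3 * σ / 4 * (1 - Real.cos θ)))) := by ring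
    _ ≤ 8 * σ / 3 * (3 / 8) := mul_le_mul_of_nonneg_left h1 (by positivity)
    _ = σ := by ring

/-- KEY 3: `(σ³·|sin θ|³·e^{−(3σ∕4)(1−cos θ)})² ≤ 4σ³` (`σ ≥ 0`): `sin⁶ ≤ 8Y³`, `(σ∕2)Y·e^{−(σ∕2)Y} ≤ 3∕8` cubed, `8·27∕8 ≤ 32`. [folklore] -/
theorem key_D3_sq_le {σ : ℝ} (hσ : 0 ≤ σ) (θ : ℝ) : (σ ^ 3 * |Real.sin θ| ^ 3 * Real.exp (-(3 * σ / 4 * (1 - Real.cos θ)))) ^ 2 ≤ 4 * σ ^ 3 := by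
  have hY0 : 0 ≤ 1 - Real.cos θ := by linarith [Real.cos_le_one θ]
  have hs := sin_sq_le_two_mul_one_sub_cos θ
  -- `u := (σ/2)·Y·e^{−(σ/2)Y} ≤ 3/8`, `u ≥ 0`
  have hu := mul_one_sub_cos_mul_exp_le (σ / 2) θ
  have hu0 : 0 ≤ σ / 2 * (1 - Real.cos θ) * Real.exp (-(σ / 2 * (1 - Real.cos θ))) := by positivity
  have hu3 : (σ / 2 * (1 - Real.cos θ) * Real.exp (-(σ / 2 * (1 - Real.cos θ)))) ^ 3 ≤ (3 / 8) ^ 3 := pow_le_pow_left₀ hu0 hu 3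
  -- `sin⁶ ≤ (2Y)³`
  have hs6 : |Real.sin θ| ^ 6 ≤ (2 * (1 - Real.cos θ)) ^ 3 := by
    rw [show |Real.sin θ| ^ 6 = (Real.sin θ ^ 2) ^ 3 by rw [← sq_abs]; ring]
    exact pow_le_pow_left₀ (sq_nonneg _) hs 3
  have e : (σ ^ 3 * |Real.sin θ| ^ 3 * Real.exp (-(3 * σ / 4 * (1 - Real.cos θ)))) ^ 2
      = σ ^ 3 * |Real.sin θ| ^ 6 * (σ ^ 3 * Real.exp (-(σ / 2 * (1 - Real.cos θ))) ^ 3) := by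
    rw [show Real.exp (-(σ / 2 * (1 - Real.cos θ))) ^ 3 = Real.exp (-(3 * σ / 4 * (1 - Real.cos θ))) ^ 2 by
      rw [← Real.exp_nat_mul, ← Real.exp_nat_mul]; push_cast; ring_nf]
    ring
  rw [e]
  have e2 : (σ / 2 * (1 - Real.cos θ) * Real.exp (-(σ / 2 * (1 - Real.cos θ)))) ^ 3
      = (1 - Real.cos θ) ^ 3 * (σ ^ 3 * Real.exp (-(σ / 2 * (1 - Real.cos θ))) ^ 3) / 8 := by ring
  rw [e2] at hu3
  have hA0 : 0 ≤ σ ^ 3 * Real.exp (-(σ / 2 * (1 - Real.cos θ))) ^ 3 := by positivity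
  calc σ ^ 3 * |Real.sin θ| ^ 6 * (σ ^ 3 * Real.exp (-(σ / 2 * (1 - Real.cos θ))) ^ 3)
      ≤ σ ^ 3 * (2 * (1 - Real.cos θ)) ^ 3 * (σ ^ 3 * Real.exp (-(σ / 2 * (1 - Real.cos θ))) ^ 3) := by gcongr
    _ = 64 * σ ^ 3 * ((1 - Real.cos θ) ^ 3 * (σ ^ 3 * Real.exp (-(σ / 2 * (1 - Real.cos θ))) ^ 3) / 8) := by ring
    _ ≤ 64 * σ ^ 3 * (3 / 8) ^ 3 := mul_le_mul_of_nonneg_left hu3 (by positivity)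
    _ ≤ 4 * σ ^ 3 := by nlinarith [pow_nonneg hσ 3]

/-- KEY 3, extracted: `σ³·|sin θ|³·e^{−(3σ∕4)(1−cos θ)} ≤ 2σ√σ`. [folklore] -/
theorem key_D3_le_sqrt {σ : ℝ} (hσ : 0 ≤ σ) (θ : ℝ) : σ ^ 3 * |Real.sin θ| ^ 3 * Real.exp (-(3 * σ / 4 * (1 - Real.cos θ))) ≤ 2 * σ * Real.sqrt σ := by
  have h := Real.abs_le_sqrt (key_D3_sq_le hσ θ)
  rw [abs_of_nonneg (by positivity)] at h
  have e : Real.sqrt (4 * σ ^ 3) = 2 * σ * Real.sqrt σ := by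
    rw [show (4 : ℝ) * σ ^ 3 = (2 * σ) ^ 2 * σ by ring, Real.sqrt_mul (by positivity), Real.sqrt_sq (by positivity)]
  rwa [e] at h

/-! ## §3 The half-power Gaussian localisations of `∂heat`, `∂²heat`, `∂³heat` (and `∂⁴heat` respelled) -/

/-- ★★ **`|∂_θ heat| = |kingHeatD1 σ θ| ≤ √σ·e^{−(σ∕4)(1−cos θ)}`** for every `σ ≥ 0` (`∂heat = −σ sin θ·heat`; KEY 1 against three quarters of the Gaussian, the last quarter kept).
[folklore] -/
theorem abs_kingHeatD1_le {σ : ℝ} (hσ : 0 ≤ σ) (θ : ℝ) : |kingHeatD1 σ θ| ≤ Real.sqrt σ * Real.exp (-(σ / 4 * (1 - Real.cos θ))) := by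
  have hkey := key_D1_le_sqrt hσ θ
  have hE0 : 0 ≤ Real.exp (-(σ / 4 * (1 - Real.cos θ))) := (Real.exp_pos _).le
  have e : |kingHeatD1 σ θ| = σ * |Real.sin θ| * Real.exp (-(3 * σ / 4 * (1 - Real.cos θ))) * Real.exp (-(σ / 4 * (1 - Real.cos θ))) := by
    unfold kingHeatD1
    rw [heat_eq_threeQuarter_mul_quarter, abs_mul, abs_mul, abs_neg, abs_mul, abs_of_nonneg hσ, abs_of_pos (Real.exp_pos _), abs_of_pos (Real.exp_pos _)]
    ring
  rw [e]
  exact mul_le_mul_of_nonneg_right hkey hE0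

/-- ★★ **`|∂_θ² heat| = |kingHeatD2 σ θ| ≤ 2σ·e^{−(σ∕4)(1−cos θ)}`** for every `σ ≥ 0` (`∂²heat = (−σcos + σ²sin²)heat`; `σ|cos|heat ≤ σ`, KEY 2 for the second term). [folklore] -/
theorem abs_kingHeatD2_le {σ : ℝ} (hσ : 0 ≤ σ) (θ : ℝ) : |kingHeatD2 σ θ| ≤ 2 * σ * Real.exp (-(σ / 4 * (1 - Real.cos θ))) := by
  set E := Real.exp (-(σ / 4 * (1 - Real.cos θ))) with hE
  set E3 := Real.exp (-(3 * σ / 4 * (1 - Real.cos θ))) with hE3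
  have hE0 : 0 ≤ E := (Real.exp_pos _).le
  have hE30 : 0 ≤ E3 := (Real.exp_pos _).le
  have hE31 : E3 ≤ 1 := exp_neg_mul_one_sub_cos_le_one (b := 3 * σ / 4) (by positivity) θ
  have hsplit : heat σ θ = E3 * E := heat_eq_threeQuarter_mul_quarter σ θ
  have hc1 : |Real.cos θ| ≤ 1 := Real.abs_cos_le_one θ
  have t1 : |σ * Real.cos θ * heat σ θ| ≤ σ * E := by
    rw [abs_mul, abs_mul, abs_of_nonneg hσ, abs_of_pos (heat_pos σ θ), hsplit]
    calc σ * |Real.cos θ| * (E3 * E) ≤ σ * 1 * (1 * E) := by gcongr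
      _ = σ * E := by ring
  have t2 : |σ ^ 2 * Real.sin θ ^ 2 * heat σ θ| ≤ σ * E := by
    rw [abs_of_nonneg (by have := heat_pos σ θ; positivity), hsplit, show σ ^ 2 * Real.sin θ ^ 2 * (E3 * E) = (σ ^ 2 * Real.sin θ ^ 2 * E3) * E by ring]
    exact mul_le_mul_of_nonneg_right (key_D2_le hσ θ) hE0
  have hsum : kingHeatD2 σ θ = -(σ * Real.cos θ * heat σ θ) + σ ^ 2 * Real.sin θ ^ 2 * heat σ θ := by unfold kingHeatD2; ring
  rw [hsum]
  calc |-(σ * Real.cos θ * heat σ θ) + σ ^ 2 * Real.sin θ ^ 2 * heat σ θ| ≤ |-(σ * Real.cos θ * heat σ θ)| + |σ ^ 2 * Real.sin θ ^ 2 * heat σ θ| := abs_add_le _ _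
    _ = |σ * Real.cos θ * heat σ θ| + |σ ^ 2 * Real.sin θ ^ 2 * heat σ θ| := by rw [abs_neg]
    _ ≤ σ * E + σ * E := add_le_add t1 t2
    _ = 2 * σ * E := by ring

/-- ★★ **`|∂_θ³ heat| = |kingHeatD3 σ θ| ≤ (1 + 5σ)·√σ·e^{−(σ∕4)(1−cos θ)}`** for every `σ ≥ 0` (`∂³heat = (σ sin + 3σ² sin cos − σ³ sin³)heat`: KEY 1 (`√σ`), `3σ`·KEY 1 (`3σ√σ`), KEY 3 (`2σ√σ`)).
[folklore] -/
theorem abs_kingHeatD3_le {σ : ℝ} (hσ : 0 ≤ σ) (θ : ℝ) : |kingHeatD3 σ θ| ≤ (1 + 5 * σ) * Real.sqrt σ * Real.exp (-(σ / 4 * (1 - Real.cos θ))) := by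
  set E := Real.exp (-(σ / 4 * (1 - Real.cos θ))) with hE
  set E3 := Real.exp (-(3 * σ / 4 * (1 - Real.cos θ))) with hE3
  have hE0 : 0 ≤ E := (Real.exp_pos _).le
  have hE30 : 0 ≤ E3 := (Real.exp_pos _).le
  have hsplit : heat σ θ = E3 * E := heat_eq_threeQuarter_mul_quarter σ θ
  have hc1 : |Real.cos θ| ≤ 1 := Real.abs_cos_le_one θ
  have hk1 := key_D1_le_sqrt hσ θ
  have hk3 := key_D3_le_sqrt hσ θ
  have hsq0 : 0 ≤ Real.sqrt σ := Real.sqrt_nonneg σ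
  have t1 : |σ * Real.sin θ * heat σ θ| ≤ Real.sqrt σ * E := by
    rw [abs_mul, abs_mul, abs_of_nonneg hσ, abs_of_pos (heat_pos σ θ), hsplit, show σ * |Real.sin θ| * (E3 * E) = (σ * |Real.sin θ| * E3) * E by ring]
    exact mul_le_mul_of_nonneg_right hk1 hE0
  have t2 : |3 * σ ^ 2 * Real.sin θ * Real.cos θ * heat σ θ| ≤ 3 * σ * Real.sqrt σ * E := by
    rw [abs_mul, abs_of_pos (heat_pos σ θ), abs_mul, abs_mul, abs_of_nonneg (by positivity : (0:ℝ) ≤ 3 * σ ^ 2), hsplit]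
    calc 3 * σ ^ 2 * |Real.sin θ| * |Real.cos θ| * (E3 * E) ≤ 3 * σ ^ 2 * |Real.sin θ| * 1 * (E3 * E) := by gcongr
      _ = 3 * σ * ((σ * |Real.sin θ| * E3) * E) := by ring
      _ ≤ 3 * σ * (Real.sqrt σ * E) := mul_le_mul_of_nonneg_left (mul_le_mul_of_nonneg_right hk1 hE0) (by positivity)
      _ = 3 * σ * Real.sqrt σ * E := by ring
  have t3 : |σ ^ 3 * Real.sin θ ^ 3 * heat σ θ| ≤ 2 * σ * Real.sqrt σ * E := by
    rw [abs_mul, abs_of_pos (heat_pos σ θ), abs_mul, abs_of_nonneg (pow_nonneg hσ 3), abs_pow, hsplit,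
      show σ ^ 3 * |Real.sin θ| ^ 3 * (E3 * E) = (σ ^ 3 * |Real.sin θ| ^ 3 * E3) * E by ring]
    exact mul_le_mul_of_nonneg_right hk3 hE0
  have hsum : kingHeatD3 σ θ = σ * Real.sin θ * heat σ θ + 3 * σ ^ 2 * Real.sin θ * Real.cos θ * heat σ θ - σ ^ 3 * Real.sin θ ^ 3 * heat σ θ := by
    unfold kingHeatD3; ring
  rw [hsum]
  have s1 := abs_sub (σ * Real.sin θ * heat σ θ + 3 * σ ^ 2 * Real.sin θ * Real.cos θ * heat σ θ) (σ ^ 3 * Real.sin θ ^ 3 * heat σ θ)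
  have s2 := abs_add_le (σ * Real.sin θ * heat σ θ) (3 * σ ^ 2 * Real.sin θ * Real.cos θ * heat σ θ)
  have htot : Real.sqrt σ * E + 3 * σ * Real.sqrt σ * E + 2 * σ * Real.sqrt σ * E = (1 + 5 * σ) * Real.sqrt σ * E := by ring
  linarith [t1, t2, t3, s1, s2]

/-- ★ PART Ϣ-a's fourth-derivative bound respelled with the quarter Gaussian: `|kingHeatD4 σ θ| ≤ (7σ + 21σ²)·(e^{−(σ∕4)(1−cos θ)})²` (`σ ≥ 0`). [folklore] -/
theorem abs_kingHeatD4_le_quarter_sq {σ : ℝ} (hσ : 0 ≤ σ) (θ : ℝ) :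
    |kingHeatD4 σ θ| ≤ (7 * σ + 21 * σ ^ 2) * Real.exp (-(σ / 4 * (1 - Real.cos θ))) ^ 2 := by
  rw [← exp_half_eq_quarter_sq]; exact abs_kingHeatD4_le hσ θ

/-- `heat σ θ = kingHeatChain σ 0 θ ≤ e^{−(σ∕4)(1−cos θ)}` in absolute value (`σ ≥ 0`). [folklore] -/
theorem abs_kingHeatChain_zero_le {σ : ℝ} (hσ : 0 ≤ σ) (θ : ℝ) : |kingHeatChain σ 0 θ| ≤ Real.exp (-(σ / 4 * (1 - Real.cos θ))) := by
  rw [kingHeatChain_zero, abs_of_pos (heat_pos σ θ)]; exact heat_le_exp_quarter hσ θ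

/-- ★ THE CHAIN FORM: for `j ≤ 3`, `|kingHeatChain σ j θ| ≤ w_j(σ)·e^{−(σ∕4)(1−cos θ)}` with `w₀ = 1`, `w₁ = √σ`, `w₂ = 2σ`, `w₃ = (1+5σ)√σ` — the weights PART ∇-c sums over the windows.
[folklore] -/
theorem abs_kingHeatChain_le_quarter {σ : ℝ} (hσ : 0 ≤ σ) (θ : ℝ) (j : ℕ) (hj : j ≤ 3) :
    |kingHeatChain σ j θ| ≤ (match j with | 0 => 1 | 1 => Real.sqrt σ | 2 => 2 * σ | _ => (1 + 5 * σ) * Real.sqrt σ) * Real.exp (-(σ / 4 * (1 - Real.cos θ))) := by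
  match j, hj with
  | 0, _ => simpa using abs_kingHeatChain_zero_le hσ θ
  | 1, _ => exact abs_kingHeatD1_le hσ θ
  | 2, _ => exact abs_kingHeatD2_le hσ θ
  | 3, _ => exact abs_kingHeatD3_le hσ θ

end Summit.QuantumFields.YangMills.BalabanUVNodes.N15KingModelRung.HeatKernel

end
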